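import Summits.CriticalPhenomena.CardyFormulaZ2.Theorems.DyadicBetaRigidityDyadicBetaSuffices
import Summits.CriticalPhenomena.CardyFormulaZ2.Theorems.DyadicBetaRigidityDyadicLatticeBetaLawOfComparison
import Summits.CriticalPhenomena.CardyFormulaZ2.Theorems.CardyTensorRGPolyominoToJordan
import Summits.CriticalPhenomena.CardyFormulaZ2.Theses.CardyTensorRG
import Literature.Probability.RandomPlanarGeometry.ConformalRectangleProofs

/-!
# The dyadic lattice beta law IS the polyomino Gaussian law: two open cruxes of two routes coincide

Crux `DyadicLatticeBetaLaw` (stmt-CriticalPhenomena-18183, route `DyadicBetaRigidity` of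
`CardyFormulaZ2`), line `Sketch`, registered support stub `stub_crux_iff_polyominoGaussianLaw`.
The two open law-cruxes of the two RG routes of `CardyFormulaZ2` are EQUIVALENT in the tree:

* `DyadicBetaRigidity.DyadicLatticeBetaLaw` — ONE exponent `a ∈ (0,1)` such that every conformal
  rectangle whose frontier is covered by finitely many edges of `hℤ²` (marks anywhere) has bond-`ℤ²`
  crossing probabilities converging ALONG THE DYADIC LADDER `h/2^k` to `I_a(cross-ratio)`;
* `CardyTensorRG.PolyominoGaussianLaw` (stmt-CriticalPhenomena-14337) — ONE exponent `a ∈ (0,1)`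
  such that every polyomino conformal rectangle with lattice marks has bond-`ℤ²` crossing limit
  `I_a(cross-ratio)` as `δ → 0⁺` through ALL real meshes.

`→`: the route's proved glue `DyadicBetaSuffices_proof` (stmt-18184: exact dilation covariance of the
discretisation, lattice-polygon approximation at prescribed mesh, finite scale cover, Bollobás–Riordan
sandwich) upgrades the dyadic lattice law to the full one-sided limit for EVERY conformal rectangle,
in particular for polyominoes (the polyomino hypothesis is dropped).
`←`: the proved crux `PolyominoToJordan_proof` (stmt-14338) extends the polyomino law, `I_a` being
continuous on `(0,1)` (`DyadicLattice.continuousOn_betaLaw`), to every conformal rectangle along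
`δ → 0⁺`; restricting along `h/2^k → 0⁺` (`Stubs.tendsto_dyadicMesh'`, landed with the line's
composition) gives the dyadic ladder limits (the lattice-polygon hypothesis is dropped). Here
`I_a(η) = ∫₀^η (s(1-s))^{-a} ds / ∫₀¹ (s(1-s))^{-a} ds`; the two thesis files spell it with
`∫ s in 0..η, _` notation resp. `intervalIntegral _ 0 η volume`, which are the same term.

References: B. Bollobás, O. Riordan, *Percolation* (2006), Ch. 7 §7.1 and remark p. 195;
O. Schramm, S. Smirnov, Ann. Probab. 39 (2011), Lemma 5.1.
-/

noncomputable section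

open MeasureTheory Filter Set Metric Topology
open UpperHalfPlane (upperHalfPlaneSet)
open Literature.Probability.RandomPlanarGeometry Literature.Probability.LatticeModels
open Literature.Probability.Percolation

namespace Summit.CriticalPhenomena.CardyFormulaZ2.Cruxes.DyadicLatticeBetaLaw.Stubs

namespace IffPolyomino

/-- **Polyomino law ⇒ law of every conformal rectangle.** If every polyomino conformal rectangle
with lattice marks has bond-`ℤ²` crossing limit `I_a(cross-ratio)` (`a < 1`), then so does every
conformal rectangle: the proved crux `PolyominoToJordan` applied to the continuous law `I_a`.
[cite: BollobasRiordan2006, Ch. 7 remark p. 195] -/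
theorem hasCrossingLimit_betaLaw_of_polyomino {a : ℝ} (ha : a < 1)
    (hP : ∀ R : ConformalRectangle, (∃ δ₀ : ℝ, 0 < δ₀ ∧
      (∃ s : Finset (ℤ × ℤ), R.carrier = interior (⋃ p ∈ s, {z : ℂ | δ₀ * (p.1 : ℝ) ≤ z.re ∧
        z.re ≤ δ₀ * ((p.1 : ℝ) + 1) ∧ δ₀ * (p.2 : ℝ) ≤ z.im ∧ z.im ≤ δ₀ * ((p.2 : ℝ) + 1)})) ∧
      ∀ i, ∃ m n : ℤ, R.pt i = (δ₀ : ℂ) * ((m : ℂ) + (n : ℂ) * Complex.I)) →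
      R.HasCrossingLimit (bondDomainCrossingProb R)
        (fun η : ℝ => (∫ s in (0 : ℝ)..η, (s * (1 - s)) ^ (-a)) /
          ∫ s in (0 : ℝ)..1, (s * (1 - s)) ^ (-a))) :
    ∀ R : ConformalRectangle, R.HasCrossingLimit (bondDomainCrossingProb R)
      (fun η : ℝ => (∫ s in (0 : ℝ)..η, (s * (1 - s)) ^ (-a)) /
        ∫ s in (0 : ℝ)..1, (s * (1 - s)) ^ (-a)) :=
  Summit.CriticalPhenomena.CardyFormulaZ2.Cruxes.PolyominoToJordan.Birth.PolyominoToJordan_proof _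
    (Summit.CriticalPhenomena.CardyFormulaZ2.Theorems.DyadicLattice.continuousOn_betaLaw ha) hP

end IffPolyomino

/-- **`DyadicLatticeBetaLaw ↔ PolyominoGaussianLaw`** (registered support stub
`stub_crux_iff_polyominoGaussianLaw` of crux stmt-CriticalPhenomena-18183, line `Sketch`): the
dyadic lattice-polygon beta law of route `DyadicBetaRigidity` and the polyomino Gaussian law of
route `CardyTensorRG` (stmt-CriticalPhenomena-14337) are equivalent. `→` by the proved glue
`DyadicBetaSuffices_proof` (every conformal rectangle, all real meshes); `←` by the proved crux
`PolyominoToJordan_proof` with the continuous law `I_a`, restricted along the dyadic ladder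
`h/2^k → 0⁺`. [cite: BollobasRiordan2006, Ch. 7 §7.1] -/
theorem stub_crux_iff_polyominoGaussianLaw :
    Summit.CriticalPhenomena.CardyFormulaZ2.Theses.DyadicBetaRigidity.DyadicLatticeBetaLaw ↔
    Summit.CriticalPhenomena.CardyFormulaZ2.Theses.CardyTensorRG.PolyominoGaussianLaw := by
  constructor
  · -- (→) the dyadic lattice law gives the full law of EVERY conformal rectangle
    rintro ⟨a, ha, hD⟩
    exact ⟨a, ha, fun R _ =>
      Summit.CriticalPhenomena.CardyFormulaZ2.Theorems.DyadicBetaSuffices_proof a ha hD R⟩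
  · -- (←) the polyomino law extends to every conformal rectangle; restrict along `h/2^k`
    rintro ⟨a, ha, hP⟩
    have hall := IffPolyomino.hasCrossingLimit_betaLaw_of_polyomino ha.2 hP
    refine ⟨a, ha, fun h hh R _ φ x hφ => ?_⟩
    exact (hall R φ x hφ).comp (tendsto_dyadicMesh' hh)

end Summit.CriticalPhenomena.CardyFormulaZ2.Cruxes.DyadicLatticeBetaLaw.Stubs

end
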